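import Summits.HodgeConjecture.HodgeConjecture.Theorems.Ring2AbelianAllAndrePrimitiveProjectorAlgebraic
import Summits.HodgeConjecture.HodgeConjecture.Theorems.Ring2HypothesesDescentMotivatedBoxStar
import HarnessLib

/-!
# Ring 2 hypotheses, descent face — THE LEFSCHETZ PROJECTIONS AS `*`-SANDWICHES: `B(X)` in the `⋆`-form implies that
# every projection of the Lefschetz decomposition is an ALGEBRAIC correspondence (Kleiman 1.4.4 / André Prop. 1.2, all `X`)

research route conditional on HC_CM; not a corollary; Q11.4-sentence-2 already refuted in dim ≥ 3.
Cell `pub-hodge-ring2` (Hodge ladder STAGE 3), seat `ring2-b05` (binder row b05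
`Ring2.Hypotheses.MotivatedImpliesAlgebraicAV`), gen 36. `HC_CM` (`Theses.RankFourFaces.CMAbelianHodge`) does
not occur in this file; nothing here proves a case of the Hodge conjecture; rows b05 / b10 stay OPEN.

REFEREE-AB's notice R-51 on ab-andre-2's XXII-c: the tree's `StandardConjectureBStar n X η` («`*_L` is an algebraic
correspondence, degree by degree») does not contain Kleiman's clause that the Lefschetz PROJECTORS (polynomials in `L` and
`Λ`, Kleiman 1968 §1.4 (1.4.4); André 1996 Prop. 1.2 `ℚ[L, *_L] = ℚ[L, Λ]`) are algebraic; XXII-g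
(`Ring2AbelianAllAndrePrimitiveProjectorAlgebraic`) proved the clause for the top primitive projector of an ABELIAN variety.
Here it is proved for EVERY smooth projective complex `X`, EVERY polarisation class `η` and EVERY Lefschetz index, from
`StandardConjectureBStar n X η` alone, by an explicit sandwich formula for André's sign-free involution:

  `E_k := Lᵏ ∘ *_η ∘ Lᵏ ∘ *_η : Hᵃ → Hᵃ` keeps the Lefschetz components `L^{j'} p'` (`p' ∈ P^{i'}`) with `j' ≥ k` and
  kills those with `j' < k` (`sandwich_apply_lefschetzPowTo`: `*_η (Lʲ p) = L^{n-i-j} p`), hence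
  **`π_{(i,j)} = E_j − E_{j+1}`** on `Hᵃ`, `a = i + 2j` (`internalProj_lefschetzSummand_eq_sandwich_sub`; `= E_j` when `i ≤ 1`,
  `internalProj_lefschetzSummand_eq_sandwich`),

a difference of composites of `*_η` (algebraic by `B`) and Lefschetz powers (algebraic: ab-andre-2's
`Ring2.AbelianAll.isAlgebraicCorrespondence_lefschetzPowTo`), closed under composition and differences by ab-andre-2's XXII-e
(`IsAlgebraicCorrespondence.comp` / `.sub`): **`isAlgebraicCorrespondence_internalProj_of_standardConjectureBStar`**. The same
formula with gen 36's Prop. 2.2 (`lefschetzInvolution_mem_map_corrAction`, `…MotivatedStarOperator`) re-proves, sandwich-style,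
that the projections are MOTIVATED operators (not repeated here).

No definition, no named fact, no sorry. References: Kleiman1968AlgebraicCycles (§1.4 Prop. 1.4.4, Cor. 2A11),
Andre1996Motifs (§1.1 p. 10, Prop. 1.2 p. 11, Prop. 2.2 p. 16), VoisinHodgeI2002 (§6.2.3 Cor. 6.26), Grothendieck1968 (§3).
-/

noncomputable section

-- every declaration of this problem lives in `Summit.HodgeConjecture.HodgeConjecture.…` (summit = sub-problem)
set_option linter.dupNamespace false

open CategoryTheory AlgebraicGeometry MonoidalCategory CartesianMonoidalCategory
open Literature.AlgebraicTopology.SingularHomology Literature.Geometry.Kaehler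
open Literature.AlgebraicGeometry Literature.AlgebraicGeometry.Motives
  Literature.AlgebraicGeometry.HodgeTheory

namespace Summit.HodgeConjecture.HodgeConjecture.Theorems

variable {n : ℕ} {X : SchemeOver ℂ} {η : complexBetti X 2}

/-! ## §1 The sandwich `E_k = Lᵏ ∘ * ∘ Lᵏ ∘ *` on the Lefschetz components -/

/-- **`E_k (L^{j'} p) = L^{j'} p` if `k ≤ j'`, `= 0` otherwise**, for `p ∈ P^{i'}` primitive, `i' + 2j' = a`, where
`E_k = Lᵏ ∘ *_η ∘ Lᵏ ∘ *_η : Hᵃ → Hᵇ → H^{b+2k} → H^{a₀} → Hᵃ` (`a + b = 2n`, `a₀ + 2k = a`): `*_η (L^{j'} p) = Lˢ p`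
(`i' + j' + s = n`), `Lᵏ Lˢ p` dies past the top of the string exactly when `k > j'`, and otherwise `*_η` and `Lᵏ` bring it
back to `L^{j'} p`; dead components (`i' + j' > n`) are zero on both sides. [cite: Andre1996Motifs, §1.1 (p. 10) and Prop. 1.2 (p. 11)]
[cite: VoisinHodgeI2002, §6.2.3 Cor. 6.26] -/
theorem sandwich_apply_lefschetzPowTo (hL : HasHardLefschetzProperty η n) {a b a₀ k c : ℕ} (hab : a + b = 2 * n)
    (ha : a₀ + 2 * k = a) (hc : b + 2 * k = c) (hca : c + a₀ = 2 * n) {i' j' : ℕ} (hP' : i' + 2 * j' = a)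
    {p : complexBetti X i'} (hp : p ∈ primitiveClasses η n i') :
    (lefschetzPowTo η k a₀ a ha ∘ₗ lefschetzInvolution hL hca ∘ₗ lefschetzPowTo η k b c hc ∘ₗ lefschetzInvolution hL hab)
        (lefschetzPowTo η j' i' a hP' p) = if k ≤ j' then lefschetzPowTo η j' i' a hP' p else 0 := by
  by_cases hlive : i' + j' ≤ n
  · obtain ⟨s, hs⟩ : ∃ s, i' + j' + s = n := ⟨n - (i' + j'), by omega⟩
    simp only [LinearMap.comp_apply]
    rw [lefschetzInvolution_lefschetzPowTo_eq hL hs hP' hab (show i' + 2 * s = b by omega) p,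
      lefschetzPowTo_comp_apply η rfl _ hc (show i' + 2 * (s + k) = c by omega) p]
    split_ifs with hk
    · obtain ⟨j₀, rfl⟩ : ∃ j₀, j' = j₀ + k := ⟨j' - k, by omega⟩
      rw [lefschetzInvolution_lefschetzPowTo_eq hL (show i' + (s + k) + j₀ = n by omega) _ hca
          (show i' + 2 * j₀ = a₀ by omega) p,
        lefschetzPowTo_comp_apply η (rfl : j₀ + k = j₀ + k) _ ha hP' p]
    · rw [lefschetzPowTo_eq_zero_of_mem_primitiveClasses hp _ (show n + 1 ≤ i' + (s + k) by omega), map_zero,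
        map_zero]
  · -- a dead component: `L^{j'} p = 0`
    rw [lefschetzPowTo_eq_zero_of_mem_primitiveClasses hp _ (show n + 1 ≤ i' + j' by omega), map_zero]
    split_ifs <;> rfl

/-! ## §2 The Lefschetz projections as differences of sandwiches -/

/-- **`π_{(i,j)} = E_j − E_{j+1}` on `Hᵃ`** (`a = i + 2j`, `i = i₂ + 2`, `a + b = 2n`; `X` smooth projective of dimension `n`,
`η` with the hard Lefschetz property): both sides agree on every Lefschetz component `L^{j'} ξ` — the projection keeps
exactly the components of index `(i, j)`, and `[j ≤ j'] − [j + 1 ≤ j'] = [j' = j]`. [cite: Kleiman1968AlgebraicCycles, §1.4 Prop. 1.4.4]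
[cite: Andre1996Motifs, Prop. 1.2 (p. 11)] [cite: VoisinHodgeI2002, §6.2.3 Cor. 6.26] -/
theorem internalProj_lefschetzSummand_eq_sandwich_sub (hX : IsSmoothProjective n X) (hL : HasHardLefschetzProperty η n)
    {a b i i₂ j : ℕ} (hab : a + b = 2 * n) (hP : i + 2 * j = a) (hi : i₂ + 2 = i) (h₁ : b + 2 * j + i = 2 * n)
    (h₂ : b + 2 * (j + 1) + i₂ = 2 * n) (hP₂ : i₂ + 2 * (j + 1) = a) :
    internalProj (isInternal_lefschetzSummand η n hL (fun _ hm ↦ subsingleton_complexBetti hX hm) a) ⟨(i, j), hP⟩ =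
      lefschetzPowTo η j i a hP ∘ₗ lefschetzInvolution hL h₁ ∘ₗ lefschetzPowTo η j b (b + 2 * j) rfl ∘ₗ
          lefschetzInvolution hL hab -
        lefschetzPowTo η (j + 1) i₂ a hP₂ ∘ₗ lefschetzInvolution hL h₂ ∘ₗ
          lefschetzPowTo η (j + 1) b (b + 2 * (j + 1)) rfl ∘ₗ lefschetzInvolution hL hab := by
  classical
  have hvan : ∀ m, 2 * n < m → Subsingleton (complexBetti X m) := fun m hm ↦ subsingleton_complexBetti hX hm
  refine LinearMap.ext fun x ↦ ?_
  conv_lhs => rw [← sum_lefschetzPowTo_primitivePart hL hvan x]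
  conv_rhs => rw [← sum_lefschetzPowTo_primitivePart hL hvan x]
  rw [map_sum, map_sum]
  refine Finset.sum_congr rfl fun P'' _ ↦ ?_
  obtain ⟨⟨i', j'⟩, hP'⟩ := P''
  have hξ := primitivePart_mem hL hvan ⟨(i', j'), hP'⟩ x
  have hy : lefschetzPowTo η j' i' a hP' (primitivePart η n hL hvan ⟨(i', j'), hP'⟩ x) ∈
      lefschetzSummand η n a ⟨(i', j'), hP'⟩ :=
    lefschetzPowTo_mem_lefschetzSummand hP' hξ
  rw [LinearMap.sub_apply, sandwich_apply_lefschetzPowTo hL hab hP rfl h₁ hP' hξ,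
    sandwich_apply_lefschetzPowTo hL hab hP₂ rfl h₂ hP' hξ]
  by_cases hjj : j' = j
  · subst hjj
    obtain rfl : i' = i := by omega
    rw [internalProj_apply_of_mem _ hy, if_pos le_rfl, if_neg (by omega), sub_zero]
  · rw [internalProj_apply_of_mem_ne _ ?_ hy]
    · by_cases hlt : j' < j
      · rw [if_neg (by omega), if_neg (by omega), sub_zero]
      · rw [if_pos (by omega), if_pos (by omega), sub_self]
    · exact fun h ↦ hjj (congrArg (fun q : {p : ℕ × ℕ // p.1 + 2 * p.2 = a} ↦ q.1.2) h)

/-- **`π_{(i,j)} = E_j` on `Hᵃ` when `i ≤ 1`** (there is no component with `j' > j`: `i' + 2j' = i + 2j` and `j' ≥ j + 1`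
would force `i' + 2 ≤ i`). [cite: Kleiman1968AlgebraicCycles, §1.4 Prop. 1.4.4] [cite: VoisinHodgeI2002, §6.2.3 Cor. 6.26] -/
theorem internalProj_lefschetzSummand_eq_sandwich (hX : IsSmoothProjective n X) (hL : HasHardLefschetzProperty η n)
    {a b i j : ℕ} (hab : a + b = 2 * n) (hP : i + 2 * j = a) (hi : i ≤ 1) (h₁ : b + 2 * j + i = 2 * n) :
    internalProj (isInternal_lefschetzSummand η n hL (fun _ hm ↦ subsingleton_complexBetti hX hm) a) ⟨(i, j), hP⟩ =
      lefschetzPowTo η j i a hP ∘ₗ lefschetzInvolution hL h₁ ∘ₗ lefschetzPowTo η j b (b + 2 * j) rfl ∘ₗ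
        lefschetzInvolution hL hab := by
  classical
  have hvan : ∀ m, 2 * n < m → Subsingleton (complexBetti X m) := fun m hm ↦ subsingleton_complexBetti hX hm
  refine LinearMap.ext fun x ↦ ?_
  conv_lhs => rw [← sum_lefschetzPowTo_primitivePart hL hvan x]
  conv_rhs => rw [← sum_lefschetzPowTo_primitivePart hL hvan x]
  rw [map_sum, map_sum]
  refine Finset.sum_congr rfl fun P'' _ ↦ ?_
  obtain ⟨⟨i', j'⟩, hP'⟩ := P''
  have hξ := primitivePart_mem hL hvan ⟨(i', j'), hP'⟩ x
  have hy : lefschetzPowTo η j' i' a hP' (primitivePart η n hL hvan ⟨(i', j'), hP'⟩ x) ∈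
      lefschetzSummand η n a ⟨(i', j'), hP'⟩ :=
    lefschetzPowTo_mem_lefschetzSummand hP' hξ
  rw [sandwich_apply_lefschetzPowTo hL hab hP rfl h₁ hP' hξ]
  by_cases hjj : j' = j
  · subst hjj
    obtain rfl : i' = i := by omega
    rw [internalProj_apply_of_mem _ hy, if_pos le_rfl]
  · rw [internalProj_apply_of_mem_ne _ ?_ hy, if_neg (by omega)]
    exact fun h ↦ hjj (congrArg (fun q : {p : ℕ × ℕ // p.1 + 2 * p.2 = a} ↦ q.1.2) h)

/-! ## §3 `B(X)` (`⋆`-form) implies the Lefschetz projections are algebraic correspondences -/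

/-- **KLEIMAN 1.4.4 / ANDRÉ PROP. 1.2 CLAUSE, for every smooth projective `X`**: if André's `*_η` is an algebraic
correspondence in every degree (`StandardConjectureBStar n X η`) for a polarisation class `η`, then for every degree
`a ≤ 2n` and every Lefschetz index `P = (i, j)` the projection `π_P : Hᵃ(X(ℂ); ℂ) → Lʲ Pⁱ ⊆ Hᵃ(X(ℂ); ℂ)` of the Lefschetz
decomposition is an algebraic correspondence (`IsAlgebraicCorrespondence n n X X π_P`): `π_P = E_j − E_{j+1}` (§2) with
`E_k = Lᵏ ∘ *_η ∘ Lᵏ ∘ *_η`, the factors algebraic (`B`; `Ring2.AbelianAll.isAlgebraicCorrespondence_lefschetzPowTo`) and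
algebraic correspondences closed under composition and differences (`Ring2.AbelianAll.IsAlgebraicCorrespondence.comp/.sub`).
[cite: Kleiman1968AlgebraicCycles, §1.4 Prop. 1.4.4 and Appendix to §2, 2A11] [cite: Andre1996Motifs, Prop. 1.2 (p. 11)]
[cite: Grothendieck1968, §3 p. 196 (B(X))] -/
theorem isAlgebraicCorrespondence_internalProj_of_standardConjectureBStar (hX : IsSmoothProjective n X)
    (hη : IsPolarizationClass n X η) (hB : StandardConjectureBStar n X η) {a : ℕ} (ha : a ≤ 2 * n)
    (P : {p : ℕ × ℕ // p.1 + 2 * p.2 = a}) :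
    IsAlgebraicCorrespondence n n X X
      (internalProj (isInternal_lefschetzSummand η n hη.hasHardLefschetz (fun _ hm ↦ subsingleton_complexBetti hX hm) a)
        P) := by
  have hL : HasHardLefschetzProperty η n := hη.hasHardLefschetz
  obtain ⟨b, hab⟩ : ∃ b, a + b = 2 * n := ⟨2 * n - a, by omega⟩
  obtain ⟨⟨i, j⟩, hP⟩ := P
  dsimp only at hP
  -- the sandwich `E_k` is algebraic for `2k ≤ a`
  have hE : ∀ (k a₀ : ℕ) (ha₀ : a₀ + 2 * k = a) (h₁ : b + 2 * k + a₀ = 2 * n),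
      IsAlgebraicCorrespondence n n X X (lefschetzPowTo η k a₀ a ha₀ ∘ₗ lefschetzInvolution hL h₁ ∘ₗ
        lefschetzPowTo η k b (b + 2 * k) rfl ∘ₗ lefschetzInvolution hL hab) := by
    intro k a₀ ha₀ h₁
    have hS₁ : IsAlgebraicCorrespondence n n X X (lefschetzInvolution hL hab) := hB hη a b hab
    have hL₁ : IsAlgebraicCorrespondence n n X X (lefschetzPowTo η k b (b + 2 * k) rfl) :=
      Ring2.AbelianAll.isAlgebraicCorrespondence_lefschetzPowTo hX hη.mem_algebraicClasses k b _ rfl (by omega)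
    have hS₂ : IsAlgebraicCorrespondence n n X X (lefschetzInvolution hL h₁) := hB hη _ _ h₁
    have hL₂ : IsAlgebraicCorrespondence n n X X (lefschetzPowTo η k a₀ a ha₀) :=
      Ring2.AbelianAll.isAlgebraicCorrespondence_lefschetzPowTo hX hη.mem_algebraicClasses k a₀ a ha₀ ha
    exact Ring2.AbelianAll.IsAlgebraicCorrespondence.comp hX hX hX
      (Ring2.AbelianAll.IsAlgebraicCorrespondence.comp hX hX hX
        (Ring2.AbelianAll.IsAlgebraicCorrespondence.comp hX hX hX hS₁ hL₁ (by omega)) hS₂ (by omega)) hL₂ (by omega)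
  by_cases hi : i ≤ 1
  · rw [internalProj_lefschetzSummand_eq_sandwich hX hL hab hP hi (by omega)]
    exact hE j i hP (by omega)
  · obtain ⟨i₂, hi₂⟩ : ∃ i₂, i₂ + 2 = i := ⟨i - 2, by omega⟩
    rw [internalProj_lefschetzSummand_eq_sandwich_sub hX hL hab hP hi₂ (by omega) (by omega) (by omega)]
    exact Ring2.AbelianAll.IsAlgebraicCorrespondence.sub hX hX (hE j i hP (by omega)) (hE (j + 1) i₂ (by omega) (by omega))

end Summit.HodgeConjecture.HodgeConjecture.Theorems

end
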